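import Summits.ResolutionOfSingularities.ResolutionOfSingularities.Theses.Valuative

/-!
# Milestones for the promoted stub `stub_logPrincipalization` (crux `Valuative.LuAlphaPTorsor`, line `pfaff-line-log-final-forms`)

Lead's workfile (sorries allowed). `MonNu n` is the registered stub `stub_logPrincipalization` restricted to
base dimension `≤ n` at the centre (hypothesis `ringKrullDim (A₀)_centre ≤ n`). `MonNu 1` is PROVED in the tree
(`Theorems/ValuativeLuAlphaPTorsorLogPrincipalizationLowDim.lean`, `logPrincipalization_of_ringKrullDim_le_one`,
modulo the unused `IsFractionRing` hypothesis); `MonNu 2` is the first milestone (Giraud-type normal form along a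
valuation, arbitrary ground field); `MonNu 3` is Cossart–Piltant strength; `MonNu n`, `n ≥ 4`, is open.
`stub_logPrincipalization ↔ ∀ n, MonNu n` (`monNu_all_iff`, proved below: every Noetherian local ring has finite
dimension).
-/

set_option linter.dupNamespace false

namespace Summit.ResolutionOfSingularities.ResolutionOfSingularities.Cruxes.LuAlphaPTorsor.PfaffLine.Milestones

/-- `Mon_ν(≤ n)`: the stub `stub_logPrincipalization` for bases of dimension `≤ n` at the centre. -/
def MonNu (n : ℕ) : Prop :=
  ∀ p : ℕ, p.Prime → ∀ (k K : Type) [Field k] [CharP k p] [Field K] [Algebra k K] (O : ValuationSubring K) (A₀ : Subalgebra k K) (h₀ : A₀.toSubring ≤ O.toSubring) (t : K), A₀.FG → ∀ (htp : t ^ p ∈ A₀), IsFractionRing (Algebra.adjoin k (insert t (A₀ : Set K))) K → IsRegularLocalRing (Localization.AtPrime (Ideal.comap (Subring.inclusion h₀) (IsLocalRing.maximalIdeal O))) → ringKrullDim (Localization.AtPrime (Ideal.comap (Subring.inclusion h₀) (IsLocalRing.maximalIdeal O))) ≤ n → (∀ c : Localization.AtPrime (Ideal.comap (Subring.inclusion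 h₀) (IsLocalRing.maximalIdeal O)), algebraMap A₀.toSubring (Localization.AtPrime (Ideal.comap (Subring.inclusion h₀) (IsLocalRing.maximalIdeal O))) ⟨t ^ p, htp⟩ ≠ c ^ p) → ∃ (A₁ : Subalgebra k K) (h₁ : A₁.toSubring ≤ O.toSubring) (hle : A₀ ≤ A₁), A₁.FG ∧ IsRegularLocalRing (Localization.AtPrime (Ideal.comap (Subring.inclusion h₁) (IsLocalRing.maximalIdeal O))) ∧ ∃ (d : ℕ) (u : Fin d → Localization.AtPrime (Ideal.comap (Subring.inclusion h₁) (IsLocalRing.maximalIdeal O))) (E : Finset (Fin d)) (M : Fin d → ℕ), Ideal.span (Set.range u) = IsLocalRing.maximalIdeal (Localization.AtPrime (Ideal.comap (Subring.inclusion h₁) (IsLocalRing.maximalIdeal O))) ∧ ringKrullDim (Localization.AtPrime (Ideal.comap (Subring.inclusion h₁) (IsLocalRing.maximalIdeal O))) = (d : WithBot ℕ∞) ∧ Ideal.span {b | ∃ δ : Derivation ℤ (Localization.AtPrime (Ideal.comap (Subring.inclusion h₁) (IsLocalRing.maximalIdeal O))) (Localization.AtPrime (Ideal.comap (Subring.inclusion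 h₁) (IsLocalRing.maximalIdeal O))), (∀ i ∈ E, δ (u i) ∈ Ideal.span {u i}) ∧ δ (algebraMap A₁.toSubring (Localization.AtPrime (Ideal.comap (Subring.inclusion h₁) (IsLocalRing.maximalIdeal O))) ⟨t ^ p, hle htp⟩) = b} = Ideal.span {E.prod fun i => u i ^ M i}

/-- The registered stub (copied verbatim from `Lines/pfaff-line-log-final-forms.lean`). -/
def LogPrin : Prop :=
  ∀ p : ℕ, p.Prime → ∀ (k K : Type) [Field k] [CharP k p] [Field K] [Algebra k K] (O : ValuationSubring K) (A₀ : Subalgebra k K) (h₀ : A₀.toSubring ≤ O.toSubring) (t : K), A₀.FG → ∀ (htp : t ^ p ∈ A₀), IsFractionRing (Algebra.adjoin k (insert t (A₀ : Set K))) K → IsRegularLocalRing (Localization.AtPrime (Ideal.comap (Subring.inclusion h₀) (IsLocalRing.maximalIdeal O))) → (∀ c : Localization.AtPrime (Ideal.comap (Subring.inclusion h₀) (IsLocalRing.maximalIdeal O)), algebraMap A₀.toSubring (Localization.AtPrime (Ideal.comap (Subring.inclusion h₀) (IsLocalRing.maximalIdeal O))) ⟨t ^ p, htp⟩ ≠ c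 ^ p) → ∃ (A₁ : Subalgebra k K) (h₁ : A₁.toSubring ≤ O.toSubring) (hle : A₀ ≤ A₁), A₁.FG ∧ IsRegularLocalRing (Localization.AtPrime (Ideal.comap (Subring.inclusion h₁) (IsLocalRing.maximalIdeal O))) ∧ ∃ (d : ℕ) (u : Fin d → Localization.AtPrime (Ideal.comap (Subring.inclusion h₁) (IsLocalRing.maximalIdeal O))) (E : Finset (Fin d)) (M : Fin d → ℕ), Ideal.span (Set.range u) = IsLocalRing.maximalIdeal (Localization.AtPrime (Ideal.comap (Subring.inclusion h₁) (IsLocalRing.maximalIdeal O))) ∧ ringKrullDim (Localization.AtPrime (Ideal.comap (Subring.inclusion h₁) (IsLocalRing.maximalIdeal O))) = (d : WithBot ℕ∞) ∧ Ideal.span {b | ∃ δ : Derivation ℤ (Localization.AtPrime (Ideal.comap (Subring.inclusion h₁) (IsLocalRing.maximalIdeal O))) (Localization.AtPrime (Ideal.comap (Subring.inclusion h₁) (IsLocalRing.maximalIdeal O))), (∀ i ∈ E, δ (u i) ∈ Ideal.span {u i}) ∧ δ (algebraMap A₁.toSubring (Localization.AtPrime (Ideal.comap (Subring.inclusion h₁)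 (IsLocalRing.maximalIdeal O))) ⟨t ^ p, hle htp⟩) = b} = Ideal.span {E.prod fun i => u i ^ M i}

/-- The stub is the conjunction of its dimension-bounded milestones (a regular local ring is Noetherian local,
hence of finite Krull dimension). -/
theorem monNu_all_iff : LogPrin ↔ ∀ n, MonNu n := by
  constructor
  · intro H n p hp k K _ _ _ _ O A₀ h₀ t hfg htp hfr hreg _ hpow
    exact H p hp k K O A₀ h₀ t hfg htp hfr hreg hpow
  · intro H p hp k K _ _ _ _ O A₀ h₀ t hfg htp hfr hreg hpow
    haveI := hreg
    obtain ⟨n, hn⟩ : ∃ n : ℕ, ringKrullDim (Localization.AtPrime (Ideal.comap (Subring.inclusion h₀)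
        (IsLocalRing.maximalIdeal O))) = n :=
      ⟨(IsLocalRing.maximalIdeal _).spanFinrank, (IsRegularLocalRing.spanFinrank_maximalIdeal (R := _)).symm⟩
    exact H n p hp k K O A₀ h₀ t hfg htp hfr hreg hn.le hpow

/-- MILESTONE 1 (first target of the promoted item): `Mon_ν(≤ 2)` — Giraud-type normal form of `t^p` modulo
`p`-th powers along a valuation of a regular surface germ, for an ARBITRARY ground field of characteristic `p`. -/
theorem monNu_two : MonNu 2 := by
  sorry

end Summit.ResolutionOfSingularities.ResolutionOfSingularities.Cruxes.LuAlphaPTorsor.PfaffLine.Milestones
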